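import Mathlib.Geometry.Manifold.Complex
import Mathlib.Geometry.Manifold.MFDeriv.Basic
import Mathlib.Geometry.Manifold.MFDeriv.SpecificFunctions
import Mathlib.Analysis.Complex.CauchyIntegral
import Mathlib.Analysis.Analytic.IsolatedZeros
import Mathlib.Analysis.Analytic.Uniqueness
import Mathlib.Analysis.Convex.PathConnected
import Mathlib.Analysis.Normed.Module.Connected
import Mathlib.Analysis.Normed.Module.Ball.Homeomorph
import Mathlib.LinearAlgebra.Complex.FiniteDimensional
import HarnessLib

-- provenance: harness21/H21/H21/Prelude/Kaehler/AnalyticSet.lean @ 06ba227 (interim HEAD d8f2665); M5 mechanical rewrite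
/-!
# Complex-analytic subsets of complex manifolds (trunk `Kaehler`, item K6 / D8)

An *analytic subset* `Z` of a complex manifold `M` is a subset which is, locally near every
point of `M`, the common zero locus of finitely many holomorphic functions. We set this up
pointwise-first:

* `Literature.IsAnalyticSetAt I Z x`: near `x`, `Z` is cut out by finitely many holomorphic functions;
* `Literature.IsAnalyticSetOn I Z W`: the above at every point of `W`;
* `Literature.IsAnalyticSet I Z`: the above at every point of `M` (closedness of `Z` is then a theorem,
  `Literature.Geometry.Kaehler.IsAnalyticSet.isClosed`, and `Literature.Geometry.Kaehler.isAnalyticSet_iff_isClosed_and` recovers the textbook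
  phrasing "closed and locally analytic near each of its points");
* `Literature.IsRegularPointOfCodim I Z p x`, `Literature.Geometry.Kaehler.regularLocus`, `Literature.Geometry.Kaehler.singularLocus`,
  `Literature.Geometry.Kaehler.HasPureCodim`, `Literature.Geometry.Kaehler.IsIrreducibleAnalyticSet`: regular / singular points, pure
  codimension, irreducibility.

The easy API is proved (closedness, empty set / whole space, global zero loci, preimages under
holomorphic maps, finite unions and intersections — the latter two via the componentwise
criterion `Literature.Geometry.Kaehler.mdifferentiableWithinAt_pi_space` and the reindexing lemma
`Literature.Geometry.Kaehler.IsAnalyticSetAt.of_fintype`); the deep structural theorems (density of regular points,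
analyticity of the singular locus, identity theorem, connectedness of complements, pure dimension
of irreducible sets) are vendored as *named facts* (`def … : Prop`) with citations, to be
consumed as hypotheses `(h : <fact> I M)`; two of them (identity theorem, connectedness of
complements) are moreover discharged in this file (`…_holds`). The `Prop`
`Literature.Geometry.Kaehler.IsAnalyticSet.exists_isIrreducibleAnalyticSet_subset_of_mem` kept in the same section is
*not* deep: as stated it is witnessed by a singleton and is proved here trivially
(`…_holds`, section "Singletons"); the faithful decomposition into irreducible components
[Chirka1989, §5.4] lives in `Literature/Geometry/Kaehler/IrreducibleComponents.lean`
(`Literature.Geometry.Kaehler.IsIrreducibleComponent`, `Literature.Geometry.Kaehler.IsAnalyticSet.exists_isIrreducibleComponent_of_mem`).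

## Name collision

Mathlib already has a declaration `MeasureTheory.AnalyticSet`
(`Mathlib/MeasureTheory/Constructions/Polish/Basic.lean`): those are *Suslin* analytic sets of
descriptive set theory (continuous images of Polish spaces) and are **unrelated** to the
complex-analytic sets of this file. All our predicates live in the `Literature` namespace and are
spelled `IsAnalyticSet…`. Mathlib has no notion of complex-analytic subvariety
(searched: `AnalyticSet`, `analyticSubvariety`, `zeroLocus` in `Geometry/Manifold`).

## Design choices

* The setting is a general charted space `M` over a model with corners `I : ModelWithCorners ℂ E H`;
  the definitions require no manifold hypotheses. "Holomorphic on `U`" is spelled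
  `MDifferentiableOn I 𝓘(ℂ, Fin m → ℂ) f U` (complex differentiability on an open set), which
  is genuine holomorphy only on an honest complex manifold without boundary; therefore all deep
  facts assume `[IsManifold I 1 M] [I.Boundaryless]` (holomorphic atlas, no boundary), exactly
  as `Mathlib/Geometry/Manifold/Complex.lean` does, and moreover `[FiniteDimensional ℂ E]`
  since the cited literature is finite-dimensional. (`IsManifold I ω M` would be strictly
  stronger as a typeclass assumption and would make the facts unusable for a Mathlib-style
  complex manifold, so it is *not* used.) In the deep facts the model `I` and the manifold `M`
  are explicit arguments, so that `(h : Literature.isAnalyticSet_singularLocus I M)` elaborates, and the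
  three manifold hypotheses are `∀ [·]`-bound inside each fact's body.
* In `IsAnalyticSetAt`, the number `m` of local equations may be `0`; then `f ⁻¹' {0} = univ`
  and the condition reads `Z ∩ U = U`, i.e. `Z` contains a neighbourhood of `x`.
* Defining functions are global maps `f : M → (Fin m → ℂ)` only required to be differentiable on
  `U` (values outside `U` are irrelevant), avoiding subtype-valued domains.

## References

* P. Griffiths, J. Harris, *Principles of Algebraic Geometry* (1978), Ch. 0 §§1–2
  [GriffithsHarrisPrinciples1978].
* R. C. Gunning, H. Rossi, *Analytic Functions of Several Complex Variables* (1965),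
  Ch. II–III, V.
* E. M. Chirka, *Complex Analytic Sets* (1989), §§2, 5 [Chirka1989].
-/

open scoped Manifold ContDiff Topology
open Set

namespace Literature.Geometry.Kaehler

variable {E : Type*} [NormedAddCommGroup E] [NormedSpace ℂ E]
  {H : Type*} [TopologicalSpace H] (I : ModelWithCorners ℂ E H)
  {M : Type*} [TopologicalSpace M] [ChartedSpace H M]

/-! ### Definitions -/

/-- `IsAnalyticSetAt I Z x`: the subset `Z ⊆ M` is *analytic at the point* `x ∈ M`, i.e. there
is an open neighbourhood `U` of `x` and finitely many functions `f₁, …, fₘ` holomorphic on `U`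
(bundled as `f : M → (Fin m → ℂ)` with `MDifferentiableOn I 𝓘(ℂ, Fin m → ℂ) f U`) such that
`Z ∩ U = {y ∈ U | f y = 0}`. The case `m = 0` is allowed and encodes `Z ∩ U = U`.
Note that `x` need not belong to `Z`.
[Griffiths–Harris, Ch. 0 §1, "analytic varieties"; Chirka, *Complex Analytic Sets*, §2.1] [folklore] -/
def IsAnalyticSetAt (Z : Set M) (x : M) : Prop :=
  ∃ U : Set M, IsOpen U ∧ x ∈ U ∧ ∃ (m : ℕ) (f : M → (Fin m → ℂ)),
    MDifferentiableOn I 𝓘(ℂ, Fin m → ℂ) f U ∧ Z ∩ U = U ∩ f ⁻¹' {0}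

/-- `IsAnalyticSetOn I Z W`: the subset `Z ⊆ M` is analytic at every point of `W`
(see `IsAnalyticSetAt`). A subset which is analytic on itself is a *locally analytic* set.
[Chirka, *Complex Analytic Sets*, §2.1] [folklore] -/
def IsAnalyticSetOn (Z W : Set M) : Prop :=
  ∀ x ∈ W, IsAnalyticSetAt I Z x

/-- `IsAnalyticSet I Z`: `Z ⊆ M` is a (closed) *analytic subset* of `M`: near every point of `M`
it is the common zero locus of finitely many holomorphic functions. Equivalently
(`isAnalyticSet_iff_isClosed_and`), `Z` is closed and analytic at each of its own points.
[Griffiths–Harris, Ch. 0 §1; Gunning–Rossi, Ch. II §E; Chirka, §2.1] [folklore] -/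
def IsAnalyticSet (Z : Set M) : Prop :=
  ∀ x, IsAnalyticSetAt I Z x

/-- `IsRegularPointOfCodim I Z p x`: `x` is a *regular (smooth) point of codimension `p`* of
`Z`, i.e. near `x` the set `Z` is cut out by `p` holomorphic functions `f : M → (Fin p → ℂ)`
whose differential `mfderiv I 𝓘(ℂ, Fin p → ℂ) f x` at `x` is surjective (so that, by the
holomorphic implicit function theorem, `Z` is a complex submanifold of codimension `p` near `x`).
As for `IsAnalyticSetAt`, membership `x ∈ Z` is *not* part of the predicate (it is imposed in
`regularLocus`). [Griffiths–Harris, Ch. 0 §2, "smooth points"; Chirka, §2.3] [folklore] -/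
def IsRegularPointOfCodim (Z : Set M) (p : ℕ) (x : M) : Prop :=
  ∃ U : Set M, IsOpen U ∧ x ∈ U ∧ ∃ f : M → (Fin p → ℂ),
    MDifferentiableOn I 𝓘(ℂ, Fin p → ℂ) f U ∧ Z ∩ U = U ∩ f ⁻¹' {0} ∧
      Function.Surjective (mfderiv I 𝓘(ℂ, Fin p → ℂ) f x)

/-- The *regular locus* `Z_reg` of `Z ⊆ M`: the points of `Z` which are regular of some
codimension. [Griffiths–Harris, Ch. 0 §2 (`V*`); Chirka, §2.3 (`reg A`)] [folklore] -/
def regularLocus (Z : Set M) : Set M :=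
  {x ∈ Z | ∃ p, IsRegularPointOfCodim I Z p x}

/-- The *singular locus* `Z_sing := Z \ Z_reg` of `Z ⊆ M`.
[Griffiths–Harris, Ch. 0 §2 (`V_s`); Chirka, §2.3 (`sng A`)] [folklore] -/
def singularLocus (Z : Set M) : Set M :=
  Z \ regularLocus I Z

/-- `HasPureCodim I Z p`: `Z` is a nonempty analytic subset of `M` of *pure codimension `p`*,
i.e. every regular point of `Z` is regular of codimension `p`.
[Griffiths–Harris, Ch. 0 §2; Chirka, §2.4] [folklore] -/
def HasPureCodim (Z : Set M) (p : ℕ) : Prop :=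
  IsAnalyticSet I Z ∧ Z.Nonempty ∧ ∀ x ∈ regularLocus I Z, IsRegularPointOfCodim I Z p x

/-- `IsIrreducibleAnalyticSet I Z`: `Z` is a nonempty analytic subset of `M` which is
*irreducible*: whenever `Z` is covered by two analytic subsets `A ∪ B`, it is contained in one of
them (equivalently, `Z` is not the union of two proper analytic subsets).
[Griffiths–Harris, Ch. 0 §1; Gunning–Rossi, Ch. II §E Def. 14; Chirka, §5.3] [folklore] -/
def IsIrreducibleAnalyticSet (Z : Set M) : Prop :=
  IsAnalyticSet I Z ∧ Z.Nonempty ∧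
    ∀ A B : Set M, IsAnalyticSet I A → IsAnalyticSet I B → Z ⊆ A ∪ B → Z ⊆ A ∨ Z ⊆ B

/-! ### Elementary API -/

variable {I}

/-- The regular locus of `Z` is contained in `Z`. [folklore] -/
theorem regularLocus_subset (Z : Set M) : regularLocus I Z ⊆ Z := fun _ hx => hx.1

/-- The singular locus of `Z` is contained in `Z`. [folklore] -/
theorem singularLocus_subset (Z : Set M) : singularLocus I Z ⊆ Z := sdiff_subset

/-- `Z` is the disjoint union of its regular and singular loci (union part). [folklore] -/
theorem regularLocus_union_singularLocus (Z : Set M) :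
    regularLocus I Z ∪ singularLocus I Z = Z :=
  union_sdiff_cancel (regularLocus_subset Z)

/-- Restricting the set of base points preserves `IsAnalyticSetOn`. [folklore] -/
theorem IsAnalyticSetOn.mono {Z W W' : Set M} (h : IsAnalyticSetOn I Z W) (hW : W' ⊆ W) :
    IsAnalyticSetOn I Z W' := fun x hx => h x (hW hx)

/-- An analytic set is analytic on any set of base points. [folklore] -/
theorem IsAnalyticSet.isAnalyticSetOn {Z : Set M} (h : IsAnalyticSet I Z) (W : Set M) :
    IsAnalyticSetOn I Z W := fun x _ => h x

/-- A set is (vacuously) analytic at every point outside its closure: take `U := (closure Z)ᶜ`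
and the single equation `1 = 0`. [Chirka, §2.1] [folklore] -/
theorem IsAnalyticSetAt.of_notMem_closure {Z : Set M} {x : M} (hx : x ∉ closure Z) :
    IsAnalyticSetAt I Z x := by
  refine ⟨(closure Z)ᶜ, isClosed_closure.isOpen_compl, hx, 1, fun _ _ => 1,
    mdifferentiableOn_const, ?_⟩
  have h1 : (fun _ _ => (1 : ℂ) : M → Fin 1 → ℂ) ⁻¹' {0} = ∅ := by
    ext y
    simp only [mem_preimage, mem_singleton_iff, funext_iff, Pi.zero_apply, one_ne_zero,
      mem_empty_iff_false, iff_false]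
    exact fun h => h 0
  rw [h1, inter_empty, ← subset_empty_iff]
  exact fun y hy => hy.2 (subset_closure hy.1)

/-- An analytic subset of `M` is closed: near a point `x ∉ Z`, the complement of `Z` contains
the open set `{y ∈ U | f y ≠ 0}`. [Griffiths–Harris, Ch. 0 §1; Chirka, §2.1] [folklore] -/
theorem IsAnalyticSet.isClosed {Z : Set M} (h : IsAnalyticSet I Z) : IsClosed Z := by
  rw [← isOpen_compl_iff, isOpen_iff_forall_mem_open]
  intro x hx
  obtain ⟨U, hU, hxU, m, f, hf, hZU⟩ := h x
  refine ⟨U ∩ f ⁻¹' {0}ᶜ, fun y hy hyZ => hy.2 ?_, ?_, hxU, fun hfx => hx ?_⟩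
  · exact ((hZU.subset ⟨hyZ, hy.1⟩).2 : f y ∈ ({0} : Set (Fin m → ℂ)))
  · exact hf.continuousOn.isOpen_inter_preimage hU isOpen_compl_singleton
  · exact (hZU.symm.subset ⟨hxU, hfx⟩).1

/-- Textbook form of the definition: `Z` is an analytic subset of `M` iff it is closed and
locally near each of *its own* points the zero locus of finitely many holomorphic functions.
[Griffiths–Harris, Ch. 0 §1; Chirka, §2.1] [folklore] -/
theorem isAnalyticSet_iff_isClosed_and {Z : Set M} :
    IsAnalyticSet I Z ↔ IsClosed Z ∧ IsAnalyticSetOn I Z Z := by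
  refine ⟨fun h => ⟨h.isClosed, h.isAnalyticSetOn Z⟩, fun ⟨hc, h⟩ x => ?_⟩
  by_cases hx : x ∈ Z
  · exact h x hx
  · exact IsAnalyticSetAt.of_notMem_closure (by rwa [hc.closure_eq])

/-- The empty set is analytic (one equation `1 = 0`). [Chirka, §2.1] [folklore] -/
theorem isAnalyticSet_empty : IsAnalyticSet I (∅ : Set M) := fun _ =>
  IsAnalyticSetAt.of_notMem_closure (by simp)

/-- The whole manifold is analytic (no equations, `m = 0`). [Chirka, §2.1] [folklore] -/
theorem isAnalyticSet_univ : IsAnalyticSet I (univ : Set M) := by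
  intro x
  refine ⟨univ, isOpen_univ, mem_univ x, 0, fun _ => 0, mdifferentiableOn_const, ?_⟩
  ext y
  simp

/-- The global common zero locus of finitely many holomorphic functions is analytic.
[Griffiths–Harris, Ch. 0 §1] [folklore] -/
theorem isAnalyticSet_preimage_singleton_zero {m : ℕ} {f : M → (Fin m → ℂ)}
    (hf : MDifferentiable I 𝓘(ℂ, Fin m → ℂ) f) : IsAnalyticSet I (f ⁻¹' {0}) := fun x =>
  ⟨univ, isOpen_univ, mem_univ x, m, f, hf.mdifferentiableOn, by simp [inter_comm]⟩

/-! ### Componentwise differentiability and reindexing of local equations -/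

/-- A map into a finite product `Π i, F i` of complex normed spaces (with its model-space
structure `𝓘(ℂ, Π i, F i)`) is differentiable within `s` at `x` iff every component is.
Manifold analogue of `differentiableWithinAt_pi`; not in Mathlib (searched `pi` in
`Geometry/Manifold/MFDeriv`). [folklore] -/
theorem mdifferentiableWithinAt_pi_space {ι : Type*} [Fintype ι] {F : ι → Type*}
    [∀ i, NormedAddCommGroup (F i)] [∀ i, NormedSpace ℂ (F i)] {φ : M → Π i, F i}
    {s : Set M} {x : M} :
    MDifferentiableWithinAt I 𝓘(ℂ, Π i, F i) φ s x ↔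
      ∀ i, MDifferentiableWithinAt I 𝓘(ℂ, F i) (fun y => φ y i) s x := by
  simp only [mdifferentiableWithinAt_iff', continuousWithinAt_pi]
  have : ∀ (ψ : M → Π i, F i), writtenInExtChartAt I 𝓘(ℂ, Π i, F i) x ψ =
      fun e i => writtenInExtChartAt I 𝓘(ℂ, F i) x (fun y => ψ y i) e := fun ψ => rfl
  rw [this, differentiableWithinAt_pi, ← forall_and]

/-- `MDifferentiableOn` into a finite product of complex normed spaces is checked componentwise.
[folklore] -/
theorem mdifferentiableOn_pi_space {ι : Type*} [Fintype ι] {F : ι → Type*}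
    [∀ i, NormedAddCommGroup (F i)] [∀ i, NormedSpace ℂ (F i)] {φ : M → Π i, F i}
    {s : Set M} :
    MDifferentiableOn I 𝓘(ℂ, Π i, F i) φ s ↔
      ∀ i, MDifferentiableOn I 𝓘(ℂ, F i) (fun y => φ y i) s :=
  ⟨fun h i x hx => (mdifferentiableWithinAt_pi_space.1 (h x hx)) i,
    fun h x hx => mdifferentiableWithinAt_pi_space.2 fun i => h i x hx⟩

/-- **Reindexing.** To verify `IsAnalyticSetAt I Z x` one may use local holomorphic equations
indexed by an arbitrary finite type `ι` and given componentwise: if `U` is an open neighbourhood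
of `x`, each `y ↦ f y i` is complex-differentiable on `U`, and `Z ∩ U = {y ∈ U | ∀ i, f y i = 0}`,
then `Z` is analytic at `x` (transport along `Fintype.equivFin ι`). [folklore] -/
theorem IsAnalyticSetAt.of_fintype {ι : Type*} [Fintype ι] {Z U : Set M} {x : M}
    (hU : IsOpen U) (hxU : x ∈ U) (f : M → ι → ℂ)
    (hf : ∀ i, MDifferentiableOn I 𝓘(ℂ, ℂ) (fun y => f y i) U)
    (hZU : Z ∩ U = U ∩ {y | ∀ i, f y i = 0}) : IsAnalyticSetAt I Z x := by
  set e := Fintype.equivFin ι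
  refine ⟨U, hU, hxU, Fintype.card ι, fun y k => f y (e.symm k),
    mdifferentiableOn_pi_space.2 fun k => hf (e.symm k), ?_⟩
  rw [hZU]
  congr 1
  ext y
  simp only [mem_setOf_eq, mem_preimage, mem_singleton_iff, funext_iff, Pi.zero_apply]
  exact ⟨fun h k => h (e.symm k), fun h i => by simpa using h (e i)⟩

/-- Unpacking `IsAnalyticSetAt` componentwise: local equations `f y i = 0`, `i : Fin m`, each
`y ↦ f y i` complex-differentiable on `U`, with membership in `Z` characterised on `U`.
[folklore] -/
theorem IsAnalyticSetAt.exists_forall {Z : Set M} {x : M} (h : IsAnalyticSetAt I Z x) :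
    ∃ U : Set M, IsOpen U ∧ x ∈ U ∧ ∃ (m : ℕ) (f : M → (Fin m → ℂ)),
      (∀ i, MDifferentiableOn I 𝓘(ℂ, ℂ) (fun y => f y i) U) ∧
        ∀ y ∈ U, y ∈ Z ↔ ∀ i, f y i = 0 := by
  obtain ⟨U, hU, hxU, m, f, hf, hZU⟩ := h
  refine ⟨U, hU, hxU, m, f, mdifferentiableOn_pi_space.1 hf, fun y hyU => ?_⟩
  rw [← funext_iff]
  exact ⟨fun hyZ => (hZU.subset ⟨hyZ, hyU⟩).2, fun hy => (hZU.symm.subset ⟨hyU, hy⟩).1⟩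

/-! ### Finite unions and intersections -/

/-- Analyticity at a point is stable under binary intersection: intersect the two neighbourhoods
and take both families of equations together (index type `Fin m ⊕ Fin n`).
[Griffiths–Harris, Ch. 0 §1; Chirka, §2.1] [folklore] -/
theorem IsAnalyticSetAt.inter {Z Z' : Set M} {x : M} (hZ : IsAnalyticSetAt I Z x)
    (hZ' : IsAnalyticSetAt I Z' x) : IsAnalyticSetAt I (Z ∩ Z') x := by
  obtain ⟨U, hU, hxU, m, f, hf, hfZ⟩ := hZ.exists_forall
  obtain ⟨U', hU', hxU', n, g, hg, hgZ⟩ := hZ'.exists_forall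
  refine IsAnalyticSetAt.of_fintype (ι := Fin m ⊕ Fin n) (hU.inter hU') ⟨hxU, hxU'⟩
    (fun y => Sum.elim (f y) (g y)) ?_ ?_
  · rintro (i | j)
    · exact (hf i).mono inter_subset_left
    · exact (hg j).mono inter_subset_right
  · ext y
    simp only [mem_inter_iff, mem_setOf_eq, Sum.forall, Sum.elim_inl, Sum.elim_inr]
    constructor
    · rintro ⟨⟨hyZ, hyZ'⟩, hyU, hyU'⟩
      exact ⟨⟨hyU, hyU'⟩, (hfZ y hyU).1 hyZ, (hgZ y hyU').1 hyZ'⟩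
    · rintro ⟨⟨hyU, hyU'⟩, h₁, h₂⟩
      exact ⟨⟨(hfZ y hyU).2 h₁, (hgZ y hyU').2 h₂⟩, hyU, hyU'⟩

/-- Analyticity at a point is stable under binary union: intersect the two neighbourhoods and
take all products `fᵢ · gⱼ` of the defining equations (index type `Fin m × Fin n`; uses that `ℂ`
has no zero divisors; if `m = 0` or `n = 0` there are no equations and indeed `Z ∪ Z' ⊇ U ∩ U'`).
[Griffiths–Harris, Ch. 0 §1; Chirka, §2.1] [folklore] -/
theorem IsAnalyticSetAt.union {Z Z' : Set M} {x : M} (hZ : IsAnalyticSetAt I Z x)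
    (hZ' : IsAnalyticSetAt I Z' x) : IsAnalyticSetAt I (Z ∪ Z') x := by
  obtain ⟨U, hU, hxU, m, f, hf, hfZ⟩ := hZ.exists_forall
  obtain ⟨U', hU', hxU', n, g, hg, hgZ⟩ := hZ'.exists_forall
  refine IsAnalyticSetAt.of_fintype (ι := Fin m × Fin n) (hU.inter hU') ⟨hxU, hxU'⟩
    (fun y p => f y p.1 * g y p.2)
    (fun p => ((hf p.1).mono inter_subset_left).mul ((hg p.2).mono inter_subset_right)) ?_
  have key : ∀ y, y ∈ U → y ∈ U' →
      (y ∈ Z ∪ Z' ↔ ∀ p : Fin m × Fin n, f y p.1 * g y p.2 = 0) := by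
    intro y hyU hyU'
    rw [mem_union, hfZ y hyU, hgZ y hyU']
    refine ⟨?_, fun h => ?_⟩
    · rintro (h | h) p
      · rw [h p.1, zero_mul]
      · rw [h p.2, mul_zero]
    · by_contra hcon
      push Not at hcon
      obtain ⟨⟨i, hi⟩, ⟨j, hj⟩⟩ := hcon
      exact mul_ne_zero hi hj (h (i, j))
  ext y
  exact ⟨fun ⟨hyZZ, hyU, hyU'⟩ => ⟨⟨hyU, hyU'⟩, (key y hyU hyU').1 hyZZ⟩,
    fun ⟨⟨hyU, hyU'⟩, h⟩ => ⟨(key y hyU hyU').2 h, hyU, hyU'⟩⟩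

/-- `IsAnalyticSetOn` is stable under binary intersection. [folklore] -/
theorem IsAnalyticSetOn.inter {Z Z' W : Set M} (hZ : IsAnalyticSetOn I Z W)
    (hZ' : IsAnalyticSetOn I Z' W) : IsAnalyticSetOn I (Z ∩ Z') W :=
  fun x hx => (hZ x hx).inter (hZ' x hx)

/-- `IsAnalyticSetOn` is stable under binary union. [folklore] -/
theorem IsAnalyticSetOn.union {Z Z' W : Set M} (hZ : IsAnalyticSetOn I Z W)
    (hZ' : IsAnalyticSetOn I Z' W) : IsAnalyticSetOn I (Z ∪ Z') W :=
  fun x hx => (hZ x hx).union (hZ' x hx)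

/-- A finite intersection of analytic subsets is analytic (locally, concatenate the defining
equations). [Griffiths–Harris, Ch. 0 §1; Chirka, §2.1] [folklore] -/
theorem IsAnalyticSet.inter {Z Z' : Set M} (hZ : IsAnalyticSet I Z) (hZ' : IsAnalyticSet I Z') :
    IsAnalyticSet I (Z ∩ Z') :=
  fun x => (hZ x).inter (hZ' x)

/-- A finite union of analytic subsets is analytic (locally, take all products `fᵢ gⱼ` of the
defining equations). [Griffiths–Harris, Ch. 0 §1; Chirka, §2.1] [folklore] -/
theorem IsAnalyticSet.union {Z Z' : Set M} (hZ : IsAnalyticSet I Z) (hZ' : IsAnalyticSet I Z') :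
    IsAnalyticSet I (Z ∪ Z') :=
  fun x => (hZ x).union (hZ' x)

/-- Finite unions indexed by a `Finset` of analytic subsets are analytic. [folklore] -/
theorem isAnalyticSet_biUnion_finset {ι : Type*} (s : Finset ι) {Z : ι → Set M}
    (hZ : ∀ i ∈ s, IsAnalyticSet I (Z i)) : IsAnalyticSet I (⋃ i ∈ s, Z i) := by
  classical
  induction s using Finset.induction_on with
  | empty => simpa using isAnalyticSet_empty
  | insert a s ha ih =>
    rw [Finset.set_biUnion_insert]
    exact (hZ a (Finset.mem_insert_self a s)).union
      (ih fun i hi => hZ i (Finset.mem_insert_of_mem hi))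

/-- Finite intersections indexed by a `Finset` of analytic subsets are analytic. [folklore] -/
theorem isAnalyticSet_biInter_finset {ι : Type*} (s : Finset ι) {Z : ι → Set M}
    (hZ : ∀ i ∈ s, IsAnalyticSet I (Z i)) : IsAnalyticSet I (⋂ i ∈ s, Z i) := by
  classical
  induction s using Finset.induction_on with
  | empty => simpa using isAnalyticSet_univ
  | insert a s ha ih =>
    rw [Finset.set_biInter_insert]
    exact (hZ a (Finset.mem_insert_self a s)).inter
      (ih fun i hi => hZ i (Finset.mem_insert_of_mem hi))

section Preimage

variable {E' : Type*} [NormedAddCommGroup E'] [NormedSpace ℂ E']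
  {H' : Type*} [TopologicalSpace H'] {I' : ModelWithCorners ℂ E' H'}
  {M' : Type*} [TopologicalSpace M'] [ChartedSpace H' M']

/-- The preimage of an analytic subset under a holomorphic map is analytic (pull back the local
defining equations). [Chirka, §2.1] [folklore] -/
theorem IsAnalyticSet.preimage {Z : Set M'} (hZ : IsAnalyticSet I' Z) {φ : M → M'}
    (hφ : MDifferentiable I I' φ) : IsAnalyticSet I (φ ⁻¹' Z) := by
  intro x
  obtain ⟨U, hU, hxU, m, f, hf, hZU⟩ := hZ (φ x)
  refine ⟨φ ⁻¹' U, hU.preimage hφ.continuous, hxU, m, f ∘ φ,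
    hf.comp hφ.mdifferentiableOn (mapsTo_preimage φ U), ?_⟩
  rw [← preimage_inter, hZU, preimage_inter, preimage_comp]

end Preimage

/-! ### Deep structural theorems (named facts)

The model `I` and the manifold `M` are explicit in the following `Prop`-valued definitions; use
them as hypotheses `(h : Literature.IsAnalyticSet.subset_closure_regularLocus I M)` etc. The manifold
hypotheses `[FiniteDimensional ℂ E] [IsManifold I 1 M] [I.Boundaryless]` are bound INSIDE each
body (a `variable` instance that the body does not use would be dropped from a `def`), so that
e.g. `#check @isAnalyticSet_singularLocus` reads
`… (I : ModelWithCorners ℂ E H) (M : Type _) [TopologicalSpace M] [ChartedSpace H M] : Prop` and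
unfolding it exhibits `∀ [FiniteDimensional ℂ E] [IsManifold I 1 M] [I.Boundaryless] ⦃Z⦄, …`
(checked in Scratch). -/

section Deep

variable (I) (M)

/-- **Regular points are dense**: every point of an analytic subset `Z` of a complex manifold is
a limit of regular points of `Z`. [Griffiths–Harris, Ch. 0 §2, p. 21]
[cite: Chirka1989, §2.4 Thm.] -/
def IsAnalyticSet.subset_closure_regularLocus : Prop :=
  ∀ [FiniteDimensional ℂ E] [IsManifold I 1 M] [I.Boundaryless] ⦃Z : Set M⦄,
    IsAnalyticSet I Z → Z ⊆ closure (regularLocus I Z)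

/-- **Cartan–Whitney**: the singular locus of an analytic subset of a complex manifold is again
an analytic subset. [Griffiths–Harris, Ch. 0 §2, p. 21; Gunning–Rossi, Ch. V §B]
[cite: Chirka1989, §5.2 Thm.] -/
def isAnalyticSet_singularLocus : Prop :=
  ∀ [FiniteDimensional ℂ E] [IsManifold I 1 M] [I.Boundaryless] ⦃Z : Set M⦄,
    IsAnalyticSet I Z → IsAnalyticSet I (singularLocus I Z)

/-- **Identity theorem for analytic sets**: a proper analytic subset of a connected complex
manifold has empty interior (it is "thin"). [Gunning–Rossi, Ch. I §A Thm. 6 and Ch. II §E]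
[cite: Chirka1989, §2.2] -/
def IsAnalyticSet.interior_eq_empty : Prop :=
  ∀ [FiniteDimensional ℂ E] [IsManifold I 1 M] [I.Boundaryless] [ConnectedSpace M] ⦃Z : Set M⦄,
    IsAnalyticSet I Z → Z ≠ univ → interior Z = ∅

/-- The complement of a proper analytic subset of a connected complex manifold is connected.
[Gunning–Rossi, Ch. I §C Cor. 11 (hypersurface case) and Ch. III; Griffiths–Harris, Ch. 0 §2]
[cite: Chirka1989, §2.2 Prop. 3] -/
def IsAnalyticSet.isPreconnected_compl : Prop :=
  ∀ [FiniteDimensional ℂ E] [IsManifold I 1 M] [I.Boundaryless] [ConnectedSpace M] ⦃Z : Set M⦄,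
    IsAnalyticSet I Z → Z ≠ univ → IsPreconnected Zᶜ

/-- An irreducible analytic subset of a complex manifold has pure (co)dimension.
[Griffiths–Harris, Ch. 0 §2, p. 21; Gunning–Rossi, Ch. III §C] [cite: Chirka1989, §5.3 Cor.] -/
def IsIrreducibleAnalyticSet.exists_hasPureCodim : Prop :=
  ∀ [FiniteDimensional ℂ E] [IsManifold I 1 M] [I.Boundaryless] ⦃Z : Set M⦄,
    IsIrreducibleAnalyticSet I Z → ∃ p, HasPureCodim I Z p

/-- Every point `x` of an analytic subset `Z` of a complex manifold lies on *some* irreducible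
analytic subset `Z' ⊆ Z` of `M`.

**Status: a trivially true `Prop`, not a deep theorem.** As stated (only *some* irreducible
analytic `Z'` is asked for), the witness `Z' := {x}` works: singletons are irreducible analytic
subsets (`isIrreducibleAnalyticSet_singleton`), and the `Prop` is discharged below by
`IsAnalyticSet.exists_isIrreducibleAnalyticSet_subset_of_mem_holds` (section "Singletons"). It is
thus only a weak corollary of the decomposition of an analytic set into irreducible components
[Chirka1989, §5.4 Thm., p. 57; Griffiths–Harris, Ch. 0 §1, p. 14; Gunning–Rossi, Ch. II §E
Thm. 15], whose actual content — `x` lies on an irreducible *component* of `Z`, i.e. on a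
*maximal* irreducible analytic subset of `Z` — is vendored faithfully as
`Literature.Geometry.Kaehler.IsAnalyticSet.exists_isIrreducibleComponent_of_mem` (with the definition
`Literature.Geometry.Kaehler.IsIrreducibleComponent` and the §5.4 Lemma/Theorem as named facts) in
`Literature/Geometry/Kaehler/IrreducibleComponents.lean`; use that statement whenever maximality
matters. The name and statement of the present `Prop` are kept unchanged for its consumers.
[folklore] -/
def IsAnalyticSet.exists_isIrreducibleAnalyticSet_subset_of_mem : Prop :=
  ∀ [FiniteDimensional ℂ E] [IsManifold I 1 M] [I.Boundaryless] ⦃Z : Set M⦄,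
    IsAnalyticSet I Z → ∀ ⦃x : M⦄, x ∈ Z →
      ∃ Z' : Set M, IsIrreducibleAnalyticSet I Z' ∧ Z' ⊆ Z ∧ x ∈ Z'

end Deep

/-! ### Proofs of `IsAnalyticSet.interior_eq_empty` and `IsAnalyticSet.isPreconnected_compl`

We follow [Chirka1989, §2.2] (Proposition 1 with its Corollary, and Proposition 3), replacing
"arcwise connected" by the (weaker) preconnectedness recorded in the named fact, and organising
both the plane step and the globalisation step through one general-topology lemma
(`isPreconnected_of_subset_closure_of_forall_nhds`): a dense subset `W` of a preconnected set
`D` is preconnected as soon as every point of `D` has a neighbourhood whose trace on `W` is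
preconnected.

* *Uniqueness theorem along complex lines* (`eqOn_zero_of_differentiableOn_of_convex`): a
  function complex-differentiable on a convex open set `B ⊆ E` and vanishing near one point
  vanishes on `B` (restrict to the complex line through that point and any other point of `B`;
  Mathlib has the one-variable facts `DifferentiableOn.analyticOnNhd` and
  `AnalyticOnNhd.eqOn_zero_of_preconnected_of_eventuallyEq_zero`). This gives
  `IsAnalyticSet.interior_eq_empty_holds` exactly as in Chirka's proof of Prop. 1: the interior
  of `Z` is open and closed.
* *Plane step* (`isPreconnected_inter_ne_zero_of_convex`): for `F` complex-differentiable on a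
  convex open `B ⊆ E`, the set `{e ∈ B | F e ≠ 0}` is preconnected: two of its points `a, b` lie
  on the complex line `L = {a + t (b - a)}`; on the plane domain `L ∩ B` the zeros of a component
  `Fᵢ` with `Fᵢ a ≠ 0` are isolated, and a plane domain minus a closed discrete set is
  preconnected (globalisation lemma + punctured discs, `isPreconnected_ball_diff_center`).
* *Globalisation*: `Zᶜ` is dense (`interior Z = ∅`) and every point of `M` has a coordinate ball
  whose trace on `Zᶜ` is the homeomorphic image of a set as in the plane step
  (`IsAnalyticSetAt.exists_ball_extChartAt`).

No Hausdorff or second-countability assumption on `M` is needed. -/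

section Proofs

open Filter

/-- **Local-to-global preconnectedness.** Let `D` be a preconnected set, `W ⊆ D` a subset with
`D ⊆ closure W`, and assume every point of `D` has a neighbourhood `N` whose trace `N ∩ W` is
preconnected. Then `W` is preconnected. [folklore] -/
theorem isPreconnected_of_subset_closure_of_forall_nhds {X : Type*} [TopologicalSpace X]
    {D W : Set X} (hD : IsPreconnected D) (hWD : W ⊆ D) (hDW : D ⊆ closure W)
    (hloc : ∀ x ∈ D, ∃ N ∈ 𝓝 x, IsPreconnected (N ∩ W)) : IsPreconnected W := by
  intro u v hu hv hWuv hWu hWv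
  by_contra hcon
  have hopen : ∀ w : Set X, IsOpen {x | ∃ N ∈ 𝓝 x, N ∩ W ⊆ w} := fun w => by
    refine isOpen_iff_mem_nhds.2 fun x ⟨N, hN, hNw⟩ => ?_
    filter_upwards [interior_mem_nhds.2 hN] with y hy
    exact ⟨interior N, isOpen_interior.mem_nhds hy,
      (inter_subset_inter_left _ interior_subset).trans hNw⟩
  have hcover : D ⊆ {x | ∃ N ∈ 𝓝 x, N ∩ W ⊆ u} ∪ {x | ∃ N ∈ 𝓝 x, N ∩ W ⊆ v} := by
    intro x hx
    obtain ⟨N, hN, hNW⟩ := hloc x hx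
    by_cases hNu : (N ∩ W ∩ u).Nonempty
    · by_cases hNv : (N ∩ W ∩ v).Nonempty
      · obtain ⟨y, hy⟩ := hNW u v hu hv (inter_subset_right.trans hWuv) hNu hNv
        exact absurd ⟨y, hy.1.2, hy.2⟩ hcon
      · refine Or.inl ⟨N, hN, fun y hy => ?_⟩
        rcases hWuv hy.2 with h | h
        · exact h
        · exact absurd ⟨y, hy, h⟩ hNv
    · refine Or.inr ⟨N, hN, fun y hy => ?_⟩
      rcases hWuv hy.2 with h | h
      · exact absurd ⟨y, hy, h⟩ hNu
      · exact h
  have hDu : (D ∩ {x | ∃ N ∈ 𝓝 x, N ∩ W ⊆ u}).Nonempty := by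
    obtain ⟨w, hwW, hwu⟩ := hWu
    exact ⟨w, hWD hwW, u, hu.mem_nhds hwu, inter_subset_left⟩
  have hDv : (D ∩ {x | ∃ N ∈ 𝓝 x, N ∩ W ⊆ v}).Nonempty := by
    obtain ⟨w, hwW, hwv⟩ := hWv
    exact ⟨w, hWD hwW, v, hv.mem_nhds hwv, inter_subset_left⟩
  obtain ⟨x, hxD, ⟨N₁, hN₁, hN₁u⟩, ⟨N₂, hN₂, hN₂v⟩⟩ :=
    hD _ _ (hopen u) (hopen v) hcover hDu hDv
  obtain ⟨y, hyN, hyW⟩ := mem_closure_iff_nhds.1 (hDW hxD) (N₁ ∩ N₂) (inter_mem hN₁ hN₂)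
  exact hcon ⟨y, hyW, hN₁u ⟨hyN.1, hyW⟩, hN₂v ⟨hyN.2, hyW⟩⟩

/-- In a real normed space of dimension `> 1`, a ball with its centre removed is preconnected:
it is the image of `{0}ᶜ` (connected, `isConnected_compl_singleton_of_one_lt_rank`) under the
homeomorphism `OpenPartialHomeomorph.univBall c r` from the whole space onto the ball.
[folklore] -/
theorem isPreconnected_ball_diff_center {F : Type*} [NormedAddCommGroup F] [NormedSpace ℝ F]
    (hF : 1 < Module.rank ℝ F) (c : F) (r : ℝ) : IsPreconnected (Metric.ball c r \ {c}) := by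
  rcases le_or_gt r 0 with hr | hr
  · rw [Metric.ball_eq_empty.2 hr, empty_sdiff]
    exact isPreconnected_empty
  have key : Metric.ball c r \ {c} = OpenPartialHomeomorph.univBall c r '' {0}ᶜ := by
    ext z
    constructor
    · rintro ⟨hz, hzc⟩
      have hz' : z ∈ (OpenPartialHomeomorph.univBall c r).target := by
        rwa [OpenPartialHomeomorph.univBall_target c hr]
      refine ⟨(OpenPartialHomeomorph.univBall c r).symm z, fun h0 => hzc ?_,
        (OpenPartialHomeomorph.univBall c r).right_inv hz'⟩
      rw [mem_singleton_iff] at h0 ⊢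
      rw [← (OpenPartialHomeomorph.univBall c r).right_inv hz', h0,
        OpenPartialHomeomorph.univBall_apply_zero]
    · rintro ⟨w, hw, rfl⟩
      refine ⟨?_, fun h => hw ?_⟩
      · rw [← OpenPartialHomeomorph.univBall_target c hr]
        exact (OpenPartialHomeomorph.univBall c r).map_source
          ((OpenPartialHomeomorph.univBall_source c r).symm ▸ mem_univ w)
      · rw [mem_singleton_iff] at h ⊢
        have h' : OpenPartialHomeomorph.univBall c r w = OpenPartialHomeomorph.univBall c r 0 := by
          rw [h, OpenPartialHomeomorph.univBall_apply_zero]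
        exact (OpenPartialHomeomorph.univBall c r).injOn
          ((OpenPartialHomeomorph.univBall_source c r).symm ▸ mem_univ w)
          ((OpenPartialHomeomorph.univBall_source c r).symm ▸ mem_univ 0) h'
  rw [key]
  exact (isConnected_compl_singleton_of_one_lt_rank hF 0).isPreconnected.image _
    (OpenPartialHomeomorph.continuous_univBall c r).continuousOn

/-- The preimage of an `ℝ`-convex set `B ⊆ E` under a complex line `t ↦ a + t • v : ℂ → E` is
`ℝ`-convex. [folklore] -/
theorem convex_preimage_line {B : Set E} (hB : Convex ℝ B) (a v : E) :
    Convex ℝ ((fun t : ℂ => a + t • v) ⁻¹' B) := by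
  intro s hs t ht θ₁ θ₂ h₁ h₂ hθ
  have key : a + (θ₁ • s + θ₂ • t) • v = θ₁ • (a + s • v) + θ₂ • (a + t • v) := by
    have ha : a = θ₁ • a + θ₂ • a := by rw [← add_smul, hθ, one_smul]
    simp only [add_smul, smul_assoc, smul_add]
    conv_lhs => rw [ha]
    abel
  show a + (θ₁ • s + θ₂ • t) • v ∈ B
  rw [key]
  exact hB hs ht h₁ h₂ hθ

section Line

variable {G : Type*} [NormedAddCommGroup G] [NormedSpace ℂ G]

/-- **Uniqueness theorem on a convex open set, via complex lines.** A function which is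
complex-differentiable on a convex open subset `B` of a complex normed space and vanishes near a
point of `B` vanishes on all of `B`: restrict it to the complex line through that point and any
other point of `B` and apply the one-variable identity theorem.
[Chirka1989, §2.2, proof of Prop. 1] [folklore] -/
theorem eqOn_zero_of_differentiableOn_of_convex [CompleteSpace G] {B : Set E} (hB : Convex ℝ B)
    (hBo : IsOpen B) {F : E → G} (hF : DifferentiableOn ℂ F B) {p : E} (hp : p ∈ B)
    (hFp : F =ᶠ[𝓝 p] 0) : EqOn F 0 B := by
  intro q hq
  set ℓ : ℂ → E := fun t => p + t • (q - p) with hℓ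
  have hℓd : Differentiable ℂ ℓ := (differentiable_id.smul_const (q - p)).const_add p
  have hℓ0 : ℓ 0 = p := by simp [hℓ]
  have hℓ1 : ℓ 1 = q := by simp [hℓ]
  have hDo : IsOpen (ℓ ⁻¹' B) := hBo.preimage hℓd.continuous
  have hDc : IsPreconnected (ℓ ⁻¹' B) := (convex_preimage_line hB p (q - p)).isPreconnected
  have hg : AnalyticOnNhd ℂ (F ∘ ℓ) (ℓ ⁻¹' B) :=
    (hF.comp hℓd.differentiableOn (mapsTo_preimage ℓ B)).analyticOnNhd hDo
  have h0 : (0 : ℂ) ∈ ℓ ⁻¹' B := by rw [mem_preimage, hℓ0]; exact hp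
  have h1 : (1 : ℂ) ∈ ℓ ⁻¹' B := by rw [mem_preimage, hℓ1]; exact hq
  have hev : F ∘ ℓ =ᶠ[𝓝 0] 0 := by
    have hc : Tendsto ℓ (𝓝 0) (𝓝 p) := by
      have := hℓd.continuous.continuousAt (x := 0)
      rwa [ContinuousAt, hℓ0] at this
    have hFp' : ∀ᶠ e in 𝓝 p, F e = 0 := hFp
    filter_upwards [hc.eventually hFp'] with t ht
    exact ht
  have := hg.eqOn_zero_of_preconnected_of_eventuallyEq_zero hDc h0 hev h1
  simpa [hℓ1] using this

end Line

/-- **Plane step: the complement of a zero locus in a convex open set is preconnected.** If `F`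
is complex-differentiable on a convex open subset `B` of a complex normed space, with values in
`Fin m → ℂ`, then `{e ∈ B | F e ≠ 0}` is preconnected: two of its points `a`, `b` lie on the
complex line `L : t ↦ a + t (b - a)`; on the plane domain `L⁻¹ B` the zeros of a component `Fᵢ`
with `Fᵢ a ≠ 0` are isolated (one-variable uniqueness theorem), so `L⁻¹ {e ∈ B | F e ≠ 0}` is a
plane domain minus a closed discrete set, hence preconnected.
[cite: Chirka1989, §2.2, proof of Prop. 3 (with Prop. 2)] -/
theorem isPreconnected_inter_ne_zero_of_convex {m : ℕ} {B : Set E} (hB : Convex ℝ B)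
    (hBo : IsOpen B) {F : E → Fin m → ℂ} (hF : DifferentiableOn ℂ F B) :
    IsPreconnected (B ∩ {e | F e ≠ 0}) := by
  refine isPreconnected_of_forall_pair fun a ha b hb => ?_
  obtain ⟨i, hi⟩ : ∃ i, F a i ≠ 0 := Function.ne_iff.1 ha.2
  set ℓ : ℂ → E := fun t => a + t • (b - a) with hℓ
  have hℓd : Differentiable ℂ ℓ := (differentiable_id.smul_const (b - a)).const_add a
  have hℓ0 : ℓ 0 = a := by simp [hℓ]
  have hℓ1 : ℓ 1 = b := by simp [hℓ]
  -- the plane domain `D = ℓ⁻¹ B`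
  set D : Set ℂ := ℓ ⁻¹' B with hD
  have hDo : IsOpen D := hBo.preimage hℓd.continuous
  have hDc : IsPreconnected D := (convex_preimage_line hB a (b - a)).isPreconnected
  have h0D : (0 : ℂ) ∈ D := by rw [hD, mem_preimage, hℓ0]; exact ha.1
  -- the scalar function `g = Fᵢ ∘ ℓ`, holomorphic on `D`, with `g 0 ≠ 0`
  set g : ℂ → ℂ := fun t => F (ℓ t) i with hg
  have hgd : DifferentiableOn ℂ g D :=
    differentiableOn_pi.1 (hF.comp hℓd.differentiableOn (mapsTo_preimage ℓ B)) i
  have hga : AnalyticOnNhd ℂ g D := hgd.analyticOnNhd hDo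
  have hg0 : g 0 ≠ 0 := by simpa [hg, hℓ0] using hi
  -- the zeros of `g` in `D` are isolated
  have hiso : ∀ t₀ ∈ D, ∀ᶠ t in 𝓝[≠] t₀, g t ≠ 0 := by
    intro t₀ ht₀
    rcases (hga t₀ ht₀).eventually_eq_zero_or_eventually_ne_zero with h | h
    · exact absurd (hga.eqOn_zero_of_preconnected_of_eventuallyEq_zero hDc ht₀ h h0D) hg0
    · exact h
  -- the trace `W = ℓ⁻¹ {e ∈ B | F e ≠ 0}` contains `D ∖ {g = 0}`
  set W : Set ℂ := ℓ ⁻¹' (B ∩ {e | F e ≠ 0}) with hW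
  have hWD : W ⊆ D := preimage_mono inter_subset_left
  have hgW : ∀ t ∈ D, g t ≠ 0 → t ∈ W := fun t ht hgt =>
    ⟨ht, fun h => hgt (by simp only [hg, h, Pi.zero_apply])⟩
  have hWpre : IsPreconnected W := by
    refine isPreconnected_of_subset_closure_of_forall_nhds hDc hWD ?_ ?_
    · -- density of `W` in `D`
      intro t₀ ht₀
      have : ∀ᶠ t in 𝓝[≠] t₀, t ∈ W :=
        ((hiso t₀ ht₀).and (mem_nhdsWithin_of_mem_nhds (hDo.mem_nhds ht₀))).mono
          fun t ht => hgW t ht.2 ht.1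
      exact mem_closure_iff_frequently.2 (this.frequently.filter_mono nhdsWithin_le_nhds)
    · -- local preconnectedness: punctured discs
      intro t₀ ht₀
      obtain ⟨ε, hε, hball⟩ :
          ∃ ε > 0, ∀ t ∈ Metric.ball t₀ ε, t ∈ D ∧ (t ≠ t₀ → g t ≠ 0) := by
        have h1 : ∀ᶠ t in 𝓝 t₀, t ∈ D := hDo.mem_nhds ht₀
        have h2 : ∀ᶠ t in 𝓝 t₀, t ≠ t₀ → g t ≠ 0 :=
          eventually_nhdsWithin_iff.1 (hiso t₀ ht₀)
        exact Metric.eventually_nhds_iff_ball.1 (h1.and h2)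
      refine ⟨Metric.ball t₀ ε, Metric.ball_mem_nhds t₀ hε, ?_⟩
      refine (isPreconnected_ball_diff_center ?_ t₀ ε).subset_closure ?_ ?_
      · rw [Complex.rank_real_complex]; exact Cardinal.one_lt_two
      · rintro t ⟨ht, htne⟩
        exact ⟨ht, hgW t (hball t ht).1 ((hball t ht).2 htne)⟩
      · calc Metric.ball t₀ ε ∩ W ⊆ Metric.ball t₀ ε := inter_subset_left
          _ ⊆ closure (Metric.ball t₀ ε ∩ {t₀}ᶜ) :=
            (dense_compl_singleton t₀).open_subset_closure_inter Metric.isOpen_ball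
          _ = closure (Metric.ball t₀ ε \ {t₀}) := rfl
  refine ⟨ℓ '' W, ?_, ⟨0, ?_, hℓ0⟩, ⟨1, ?_, hℓ1⟩, hWpre.image ℓ hℓd.continuous.continuousOn⟩
  · rintro _ ⟨t, ht, rfl⟩
    exact ht
  · show ℓ 0 ∈ B ∩ {e | F e ≠ 0}
    rw [hℓ0]; exact ha
  · show ℓ 1 ∈ B ∩ {e | F e ≠ 0}
    rw [hℓ1]; exact hb

/-- **Local equations in a coordinate ball.** On a boundaryless `C¹` (hence holomorphic) complex
manifold, if `Z` is analytic at `x` then there are a radius `r > 0` and equations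
`f : M → (Fin m → ℂ)` such that, in the extended chart `φ = extChartAt I x`, the ball
`B = ball (φ x) r` lies in `φ.target`, `f ∘ φ.symm` is complex-differentiable on `B`,
`φ.symm '' B` is an open neighbourhood of `x`, and membership in `Z` of `φ.symm e`, `e ∈ B`, is
equivalent to `f (φ.symm e) = 0`. [folklore] -/
theorem IsAnalyticSetAt.exists_ball_extChartAt [IsManifold I 1 M] [I.Boundaryless] {Z : Set M}
    {x : M} (h : IsAnalyticSetAt I Z x) :
    ∃ (m : ℕ) (f : M → (Fin m → ℂ)) (r : ℝ), 0 < r ∧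
      Metric.ball (extChartAt I x x) r ⊆ (extChartAt I x).target ∧
      DifferentiableOn ℂ (f ∘ (extChartAt I x).symm) (Metric.ball (extChartAt I x x) r) ∧
      IsOpen ((extChartAt I x).symm '' Metric.ball (extChartAt I x x) r) ∧
      x ∈ (extChartAt I x).symm '' Metric.ball (extChartAt I x x) r ∧
      ∀ e ∈ Metric.ball (extChartAt I x x) r,
        (extChartAt I x).symm e ∈ Z ↔ f ((extChartAt I x).symm e) = 0 := by
  obtain ⟨U, hU, hxU, m, f, hf, hZU⟩ := h
  have hdiff : DifferentiableOn ℂ (f ∘ (extChartAt I x).symm)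
      ((extChartAt I x).target ∩ (extChartAt I x).symm ⁻¹' U) := by
    have := (mdifferentiableOn_iff.1 hf).2 x 0
    simpa [mfld_simps] using this
  have hnhds : (extChartAt I x).target ∩ (extChartAt I x).symm ⁻¹' U ∈ 𝓝 (extChartAt I x x) :=
    inter_mem (extChartAt_target_mem_nhds x) (extChartAt_preimage_mem_nhds (hU.mem_nhds hxU))
  obtain ⟨r, hr, hball⟩ := Metric.mem_nhds_iff.1 hnhds
  have hBt : Metric.ball (extChartAt I x x) r ⊆ (extChartAt I x).target :=
    hball.trans inter_subset_left
  refine ⟨m, f, r, hr, hBt, hdiff.mono hball, ?_, ?_, fun e he => ?_⟩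
  · rw [(extChartAt I x).symm_image_eq_source_inter_preimage hBt]
    exact isOpen_extChartAt_preimage' x Metric.isOpen_ball
  · exact ⟨extChartAt I x x, Metric.mem_ball_self hr, extChartAt_to_inv x⟩
  · have heU : (extChartAt I x).symm e ∈ U := (hball he).2
    constructor
    · intro heZ
      exact (hZU.subset ⟨heZ, heU⟩).2
    · intro h0
      exact (hZU.symm.subset ⟨heU, h0⟩).1

/-- **Uniqueness theorem for analytic sets** (discharge of the named fact
`IsAnalyticSet.interior_eq_empty`): a proper analytic subset of a connected complex manifold has
empty interior. Proof as in the source: the interior of `Z` is open, and it is closed by the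
uniqueness theorem for holomorphic functions applied in a coordinate ball
(`eqOn_zero_of_differentiableOn_of_convex`); `M` being connected and `Z ≠ M`, it is empty.
[cite: Chirka1989, §2.2 Prop. 1 and Corollary] -/
theorem IsAnalyticSet.interior_eq_empty_holds (I : ModelWithCorners ℂ E H) (M : Type*)
    [TopologicalSpace M] [ChartedSpace H M] : IsAnalyticSet.interior_eq_empty I M := by
  intro _ _ _ _ Z hZ hZu
  have hclosed : IsClosed (interior Z) := by
    refine closure_subset_iff_isClosed.1 fun x hx => ?_
    obtain ⟨m, f, r, hr, hBt, hF, hNo, hxN, hNZ⟩ := (hZ x).exists_ball_extChartAt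
    obtain ⟨y, hyN, hyZ⟩ := mem_closure_iff_nhds.1 hx _ (hNo.mem_nhds hxN)
    obtain ⟨e₀, he₀, rfl⟩ := hyN
    have hFev : (f ∘ (extChartAt I x).symm) =ᶠ[𝓝 e₀] 0 := by
      have hc : ContinuousAt (extChartAt I x).symm e₀ := continuousAt_extChartAt_symm'' (hBt he₀)
      filter_upwards [hc.preimage_mem_nhds (isOpen_interior.mem_nhds hyZ),
        Metric.isOpen_ball.mem_nhds he₀] with e he heB
      exact (hNZ e heB).1 (interior_subset he)
    have hF0 : EqOn (f ∘ (extChartAt I x).symm) 0 (Metric.ball (extChartAt I x x) r) :=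
      eqOn_zero_of_differentiableOn_of_convex (convex_ball _ _) Metric.isOpen_ball hF he₀ hFev
    have hsub : (extChartAt I x).symm '' Metric.ball (extChartAt I x x) r ⊆ Z := by
      rintro _ ⟨e, he, rfl⟩
      exact (hNZ e he).2 (hF0 he)
    exact interior_maximal hsub hNo hxN
  rcases isClopen_iff.1 ⟨hclosed, isOpen_interior⟩ with h | h
  · exact h
  · have : (univ : Set M) ⊆ Z := h ▸ interior_subset
    exact absurd (univ_subset_iff.1 this) hZu

/-- **The complement of a proper analytic subset of a connected complex manifold is
(pre)connected** (discharge of the named fact `IsAnalyticSet.isPreconnected_compl`). The source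
proves arcwise connectedness; the fact records preconnectedness. Proof: `Zᶜ` is dense
(`IsAnalyticSet.interior_eq_empty_holds`), each point of `M` has a coordinate ball whose trace on
`Zᶜ` is the homeomorphic image of `{e ∈ B | F e ≠ 0}` for a Euclidean ball `B` and a holomorphic
`F` (`isPreconnected_inter_ne_zero_of_convex`), and preconnectedness globalises
(`isPreconnected_of_subset_closure_of_forall_nhds`). [cite: Chirka1989, §2.2 Prop. 3] -/
theorem IsAnalyticSet.isPreconnected_compl_holds (I : ModelWithCorners ℂ E H) (M : Type*)
    [TopologicalSpace M] [ChartedSpace H M] : IsAnalyticSet.isPreconnected_compl I M := by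
  intro _ _ _ _ Z hZ hZu
  refine isPreconnected_of_subset_closure_of_forall_nhds (D := univ) isPreconnected_univ
    (subset_univ _) ?_ fun x _ => ?_
  · rw [closure_compl, IsAnalyticSet.interior_eq_empty_holds I M hZ hZu, compl_empty]
  · obtain ⟨m, f, r, hr, hBt, hF, hNo, hxN, hNZ⟩ := (hZ x).exists_ball_extChartAt
    refine ⟨_, hNo.mem_nhds hxN, ?_⟩
    have key : (extChartAt I x).symm '' Metric.ball (extChartAt I x x) r ∩ Zᶜ =
        (extChartAt I x).symm '' (Metric.ball (extChartAt I x x) r ∩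
          {e | (f ∘ (extChartAt I x).symm) e ≠ 0}) := by
      ext y
      constructor
      · rintro ⟨⟨e, he, rfl⟩, hyZ⟩
        exact ⟨e, ⟨he, fun h0 => hyZ ((hNZ e he).2 h0)⟩, rfl⟩
      · rintro ⟨e, ⟨he, hne⟩, rfl⟩
        exact ⟨⟨e, he, rfl⟩, fun hyZ => hne ((hNZ e he).1 hyZ)⟩
    rw [key]
    exact (isPreconnected_inter_ne_zero_of_convex (convex_ball _ _) Metric.isOpen_ball hF).image
      _ ((continuousOn_extChartAt_symm x).mono (inter_subset_left.trans hBt))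

end Proofs

/-! ### Singletons; discharge of `IsAnalyticSet.exists_isIrreducibleAnalyticSet_subset_of_mem`

A one-point set `{x}` is an analytic subset of a complex manifold (in the extended chart at `x`
it is the common zero locus of the `finrank ℂ E` affine-linear coordinate functions vanishing at
`x`; away from `x` there is nothing to check since manifolds are T₁), and it is irreducible in
the sense of `IsIrreducibleAnalyticSet` for trivial set-theoretic reasons. Consequently the
`Prop` `IsAnalyticSet.exists_isIrreducibleAnalyticSet_subset_of_mem` — which only asks for
*some* irreducible analytic `Z' ⊆ Z` through `x` — is discharged by the witness `Z' := {x}`.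
Nothing from [Chirka1989] is used.

**Caveat (recorded honestly).** This shows that the vendored `Prop` is a true but *weak*
corollary of the decomposition theorem [Chirka1989, §5.4 Thm., p. 57]: it does not assert that
`Z'` is an irreducible *component* of `Z` (a maximal irreducible analytic subset of `Z`,
[Chirka1989, §5.4 Def., p. 56]), which is the actual content of that theorem. The faithful
statement is vendored separately (`Literature.Geometry.Kaehler.IsIrreducibleComponent`,
`Literature.Geometry.Kaehler.IsAnalyticSet.exists_isIrreducibleComponent_of_mem` in
`Literature/Geometry/Kaehler/IrreducibleComponents.lean`). -/

section Singleton

/-- A one-point set is analytic at its own point: on the chart domain `(chartAt H x).source`,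
`{x}` is the zero locus of `g ∘ extChartAt I x`, `g e = L (e - extChartAt I x x)`, for a
continuous linear isomorphism `L : E ≃L[ℂ] (Fin (finrank ℂ E) → ℂ)` (injectivity of the extended
chart on its source); differentiability is read in the chart `extChartAt I x` itself
(`mdifferentiableOn_iff_of_subset_source'`), where the map is the affine map `g`. [folklore] -/
theorem isAnalyticSetAt_singleton_self [FiniteDimensional ℂ E] [IsManifold I 1 M] (x : M) :
    IsAnalyticSetAt I ({x} : Set M) x := by
  set L : E ≃L[ℂ] (Fin (Module.finrank ℂ E) → ℂ) :=
    ContinuousLinearEquiv.ofFinrankEq (Module.finrank_fin_fun ℂ).symm with hL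
  set g : E → (Fin (Module.finrank ℂ E) → ℂ) := fun e => L (e - extChartAt I x x) with hg
  refine ⟨(chartAt H x).source, (chartAt H x).open_source, mem_chart_source H x,
    Module.finrank ℂ E, g ∘ extChartAt I x, ?_, ?_⟩
  · have hs : (chartAt H x).source ⊆ (extChartAt I x).source := by rw [extChartAt_source]
    have h2s : MapsTo (g ∘ extChartAt I x) (chartAt H x).source
        (extChartAt 𝓘(ℂ, Fin (Module.finrank ℂ E) → ℂ) (g (extChartAt I x x))).source := by
      rw [extChartAt_model_space_eq_id, PartialEquiv.refl_source]
      exact mapsTo_univ _ _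
    rw [mdifferentiableOn_iff_of_subset_source' hs h2s, extChartAt_model_space_eq_id,
      PartialEquiv.refl_coe, Function.id_comp]
    have hgd : Differentiable ℂ g :=
      (L : E →L[ℂ] (Fin (Module.finrank ℂ E) → ℂ)).differentiable.comp
        (differentiable_id.sub_const (extChartAt I x x))
    refine hgd.differentiableOn.congr ?_
    rintro _ ⟨y, hy, rfl⟩
    simp only [Function.comp_apply, (extChartAt I x).left_inv (hs hy)]
  · ext y
    simp only [mem_inter_iff, mem_singleton_iff, mem_preimage, Function.comp_apply, hg,
      map_sub, sub_eq_zero]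
    constructor
    · rintro ⟨rfl, hy⟩
      exact ⟨hy, rfl⟩
    · rintro ⟨hy, h⟩
      refine ⟨(extChartAt I x).injOn ?_ (mem_extChartAt_source x) (L.injective h), hy⟩
      rwa [extChartAt_source]

/-- One-point sets are analytic subsets of a (finite-dimensional, `C¹`) complex manifold: at `x`
use `isAnalyticSetAt_singleton_self`, elsewhere `IsAnalyticSetAt.of_notMem_closure` (manifolds
are T₁, `ModelWithCorners.t1Space`). [folklore] -/
theorem isAnalyticSet_singleton [FiniteDimensional ℂ E] [IsManifold I 1 M] (x : M) :
    IsAnalyticSet I ({x} : Set M) := by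
  haveI : T1Space M := ModelWithCorners.t1Space I M
  intro y
  by_cases hy : y = x
  · subst hy
    exact isAnalyticSetAt_singleton_self _
  · exact IsAnalyticSetAt.of_notMem_closure (by rwa [closure_singleton, mem_singleton_iff])

/-- One-point sets are irreducible analytic subsets (irreducibility in the covering form of
`IsIrreducibleAnalyticSet` is set-theoretically trivial for a singleton). [folklore] -/
theorem isIrreducibleAnalyticSet_singleton [FiniteDimensional ℂ E] [IsManifold I 1 M] (x : M) :
    IsIrreducibleAnalyticSet I ({x} : Set M) :=
  ⟨isAnalyticSet_singleton x, singleton_nonempty x, fun A B _ _ h => by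
    simpa only [singleton_subset_iff, mem_union] using h⟩

/-- **Discharge** of the `Prop` `IsAnalyticSet.exists_isIrreducibleAnalyticSet_subset_of_mem`
(every point `x` of an analytic subset `Z` lies on *some* irreducible analytic subset `Z' ⊆ Z`):
witnessed by `Z' := {x}` (`isIrreducibleAnalyticSet_singleton`); the hypothesis that `Z` is
analytic is not even used. In prose, the statement is a weak corollary of the decomposition into
irreducible components (Chirka, *Complex Analytic Sets*, §5.4 Thm. (2), p. 57), but this proof
uses nothing from that source; see the section docstring for the caveat and for the faithful,
stronger vendored statement `Literature.Geometry.Kaehler.IsAnalyticSet.exists_isIrreducibleComponent_of_mem`.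
Usage (as for `IsAnalyticSet.interior_eq_empty_holds`): the applied form `…_holds I M hZ hx`
elaborates directly; to obtain a *term* of type
`IsAnalyticSet.exists_isIrreducibleAnalyticSet_subset_of_mem I M` (e.g. to feed a hypothesis
`(h : … I M)` of a consumer) write `@…_holds _ _ _ _ _ I M _ _` — the `@` stops the elaborator
from unfolding the fact and eagerly instantiating the `∀ [·] ⦃Z⦄` binders of its body (checked
in a scratch file). [folklore] -/
theorem IsAnalyticSet.exists_isIrreducibleAnalyticSet_subset_of_mem_holds
    (I : ModelWithCorners ℂ E H) (M : Type*) [TopologicalSpace M] [ChartedSpace H M] :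
    IsAnalyticSet.exists_isIrreducibleAnalyticSet_subset_of_mem I M := by
  intro _ _ _ Z _ x hx
  exact ⟨{x}, isIrreducibleAnalyticSet_singleton x, singleton_subset_iff.2 hx, mem_singleton x⟩

end Singleton

end Literature.Geometry.Kaehler
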